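import Summits.ABC.ABC.Theses.CubicResolventAllowance
import Literature.NumberTheory.NumberFields.CubicFieldExplicit
import Literature.NumberTheory.EllipticCurves.GlobalMinimalModelProofs
import Literature.NumberTheory.DiophantineGeometry.EllArithGlueProofs
import Literature.NumberTheory.EllipticCurves.SzpiroOfAbcProofs
import HarnessLib
import Literature.NumberTheory.EllipticCurves.SzpiroLocalDataProofs
import Literature.NumberTheory.EllipticCurves.QuadraticTwist
import Literature.NumberTheory.DiophantineGeometry.ValuationProductElliptic
import Literature.NumberTheory.DiophantineGeometry.MinimalDiscriminantBaseChangeCongruence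
import Literature.NumberTheory.DiophantineGeometry.TateAlgorithmTameTypesOddProofs
import Literature.NumberTheory.DiophantineGeometry.MinimalDiscriminantFactorizationProofs
import Literature.NumberTheory.DiophantineGeometry.ConductorFactorizationProofs
import Literature.Barriers.ABC.SzpiroEpsilonCannotBeDropped
import Summits.ABC.ABC.Theorems.PlaceCountSzpiroPlaceBudgetPayoff
import Literature.NumberTheory.EllipticCurves.PastenValuationProductMestreOesterleProofs
import Literature.NumberTheory.DiophantineGeometry.MinimalDiscriminantProofs
import Literature.NumberTheory.CubicFields.CubicFieldSignatureFromDiscriminant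

/-!
# stub-ideation k2 (RESHAPE) — generation 17: the RE-CUT of `IndexSzpiro`, assembled and UNCONDITIONAL
(stub `stub_complexCubic`, crux stmt-ABC-22740, route-ABC-CubicResolventAllowance)

Companion of `STUB-IDEAS-stub_complexCubic-2.md` (gen 17).  This file is an ASSEMBLY CHECK: it concatenates,
VERBATIM and each in its original namespace, the sorry-free parts of four banked sketches of this crux directory —

* §A = k1 g5  `StubIdeas1G5Sketch.lean` (whole file; 0 sorry): the keystone `K6_Δ_eq_sq_mul_discr`
        (`Δ(W) = q²·d_K`) and the hook `discSqRatio`;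
* §B = k3 g3  `StubIdeas3ComplexG3Sketch.lean` §0–§L up to L2 (0 sorry in this part): `IsResolventField`,
        `DiscSqRatio`, L1 `ordMinDisc_parity`, L2 `dvd_discr_of_odd_ordMinDisc`;
* §C = k2 g4  `StubIdeas2G4Sketch.lean` §0–§T2 WITHOUT the sorried `allowanceDvd` (0 sorry in this part):
        `oddRadical`, `OddTowerSzpiro`, `AllowanceDvd`, `allowanceDvd_of_local`, `IndexSzpiro_of'`, `stubComplex_of_recut`;
* §D = k2 g7r `StubIdeas2RealG7Sketch.lean` §0–§R (0 sorry): the merge lemma `indexSzpiro_iff`;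

and then (§E, NEW, namespace `…StubIdeas2G17`) composes them BY NAME with no hypothesis left:

  `allowanceDvd'                 : AllowanceDvd`                       (was the one `sorry` of k2 g4),
  `indexSzpiro_of_oddTowerSzpiro : OddTowerSzpiro → IndexSzpiro`       (the crux from the K-free, sign-free kernel),
  `stubComplex_of_oddTowerSzpiro : OddTowerSzpiro → StubComplexCubic`  (the registered stub drops out),
  `indexSzpiro_iff_stubs         : IndexSzpiro ↔ StubRealCubic ∧ StubComplexCubic` (the sign split is free).

ZERO `sorry` in this file; `#print axioms` at the end must not mention `sorryAx`.  Nothing here is a tree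
proposal: a prover lands §A–§E as ONE sorry-free helper file under `Theorems/` (`--supports stmt-ABC-22740
--as helper`; sketches are not importable from `Theorems/`, hence the verbatim copies).  The Szpiro-strength
kernel `OddTowerSzpiro` stays OPEN (≥ abc with exponent 8 on the Hesse pencil, k1 g6/g18); this file only removes
`K`, the sign and every side hypothesis from the cut.
-/

set_option linter.dupNamespace false

/-! # §A — k1 g5 `StubIdeas1G5Sketch.lean`, verbatim (lines 44–274) -/

noncomputable section

namespace Summit.ABC.ABC.Cruxes.IndexSzpiro.StubIdeasComplexCubic1G5

open Polynomial
open Literature.NumberTheory.NumberFields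

/-- The stub, verbatim (payload `stub.signature`). -/
def Stub : Prop :=
  ∀ ε : ℝ, 0 < ε → ∃ C : ℝ, ∀ (W : WeierstrassCurve ℚ) [W.IsElliptic] (K : Type) [Field K]
    [NumberField K], Irreducible W.twoTorsionPolynomial.toPoly → Module.finrank ℚ K = 3 →
    (∃ θ : K, aeval θ W.twoTorsionPolynomial.toPoly = 0) → NumberField.discr K < 0 →
    (W.minimalDiscriminantNorm ℤ : ℝ) ≤
      C * |(NumberField.discr K : ℝ)| * (W.conductorNorm ℤ : ℝ) ^ (6 + ε)

/-! ## K1 — root transport under a change of variables (PROVED; = k2 g2 `H0a_root_transport`, there sorried) -/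

/-- **K1i (PROVED).** `ψ_{C • W}(x') = u⁻⁶ · ψ_W(u² x' + r)` over any number field `K`
(pattern and proof = `RealPeriod.eval_twoTorsionPolynomial_variableChange`, which is the case `K = ℝ`). -/
theorem K1i_aeval_twoTorsionPolynomial_smul (W : WeierstrassCurve ℚ)
    (C : WeierstrassCurve.VariableChange ℚ) (K : Type) [Field K] [NumberField K] (x : K) :
    aeval x (C • W).twoTorsionPolynomial.toPoly =
      (algebraMap ℚ K (↑C.u : ℚ))⁻¹ ^ 6 *
        aeval (algebraMap ℚ K (↑C.u : ℚ) ^ 2 * x + algebraMap ℚ K C.r)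
          W.twoTorsionPolynomial.toPoly := by
  have hu : algebraMap ℚ K (↑C.u : ℚ) ≠ 0 := by simp
  simp only [WeierstrassCurve.twoTorsionPolynomial, Cubic.toPoly, map_add, map_mul, map_pow,
    aeval_C, aeval_X, WeierstrassCurve.variableChange_b₂, WeierstrassCurve.variableChange_b₄,
    WeierstrassCurve.variableChange_b₆, Units.val_inv_eq_inv_val, map_inv₀, map_ofNat]
  field_simp
  ring

/-- **K1 (PROVED from K1i).** Root transport: `u⁻²(θ - r)` is a root of `ψ_{C • W}`. -/
theorem K1_root_transport (W : WeierstrassCurve ℚ) (C : WeierstrassCurve.VariableChange ℚ)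
    (K : Type) [Field K] [NumberField K] {θ : K} (hθ : aeval θ W.twoTorsionPolynomial.toPoly = 0) :
    aeval (algebraMap ℚ K ((↑C.u⁻¹ : ℚ) ^ 2) * (θ - algebraMap ℚ K C.r))
      (C • W).twoTorsionPolynomial.toPoly = 0 := by
  have hu : algebraMap ℚ K (↑C.u : ℚ) ≠ 0 := by simp
  rw [K1i_aeval_twoTorsionPolynomial_smul]
  have : algebraMap ℚ K (↑C.u : ℚ) ^ 2 * (algebraMap ℚ K ((↑C.u⁻¹ : ℚ) ^ 2) *
      (θ - algebraMap ℚ K C.r)) + algebraMap ℚ K C.r = θ := by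
    rw [Units.val_inv_eq_inv_val, map_pow, map_inv₀]
    field_simp
    ring
  rw [this, hθ, mul_zero]

/-! ## K2 — the monic model cubic of an integral model (VERIFIED; = k2 g2 `H0b_monic_rescaling`) -/

/-- **K2i (VERIFIED).** `g(4x) = 16·ψ₂(x)` for the monic model cubic `g = X³ + b₂X² + 8b₄X + 16b₆`. -/
theorem K2i_aeval_monic (W₀ : WeierstrassCurve ℤ) (K : Type) [Field K] [NumberField K] (x : K) :
    aeval ((4 : K) * x) (MonicCubic.poly W₀.b₂ (8 * W₀.b₄) (16 * W₀.b₆)) =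
      16 * aeval x (W₀.map (Int.castRingHom ℚ)).twoTorsionPolynomial.toPoly := by
  simp [MonicCubic.poly, WeierstrassCurve.twoTorsionPolynomial, Cubic.toPoly,
    WeierstrassCurve.map_b₂, WeierstrassCurve.map_b₄, WeierstrassCurve.map_b₆, map_ofNat]
  ring

/-- **K2a (VERIFIED).** `4θ'` is a root of the MONIC integer cubic `X³ + b₂X² + 8b₄X + 16b₆ = 16·ψ₂(X/4)`. -/
theorem K2a_monic_root (W₀ : WeierstrassCurve ℤ) (K : Type) [Field K] [NumberField K] {θ' : K}
    (hθ' : aeval θ' (W₀.map (Int.castRingHom ℚ)).twoTorsionPolynomial.toPoly = 0) :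
    aeval ((4 : K) * θ') (MonicCubic.poly W₀.b₂ (8 * W₀.b₄) (16 * W₀.b₆)) = 0 := by
  rw [K2i_aeval_monic, hθ', mul_zero]

/-- **K2b.** `disc(X³ + b₂X² + 8b₄X + 16b₆) = 2⁸ · Δ` (uses only `4b₈ = b₂b₆ - b₄²`). -/
theorem K2b_monic_disc (W₀ : WeierstrassCurve ℤ) :
    MonicCubic.disc W₀.b₂ (8 * W₀.b₄) (16 * W₀.b₆) = 2 ^ 8 * W₀.Δ := by
  simp only [MonicCubic.disc, WeierstrassCurve.Δ, WeierstrassCurve.b₂, WeierstrassCurve.b₄,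
    WeierstrassCurve.b₆, WeierstrassCurve.b₈]
  ring

/-! ## K3 — irreducibility of the monic model cubic WITHOUT a composition lemma (PROVED; = k2 g2 `H0c`, there sorried) -/

/-- **K3a (PROVED).** A rational root `q` of the monic model cubic of `W₀` with `W₀ ⊗ ℚ = C • W` gives the
rational root `u²·(q/4) + r` of `ψ_W` (the inverse substitution of K1; pure computation). -/
theorem K3a_rat_root_back (W : WeierstrassCurve ℚ) (C : WeierstrassCurve.VariableChange ℚ)
    (W₀ : WeierstrassCurve ℤ) (hC : W₀.map (Int.castRingHom ℚ) = C • W) (q : ℚ)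
    (hq : aeval q (MonicCubic.polyQ W₀.b₂ (8 * W₀.b₄) (16 * W₀.b₆)) = 0) :
    aeval ((↑C.u : ℚ) ^ 2 * (q / 4) + C.r) W.twoTorsionPolynomial.toPoly = 0 := by
  have hu : (↑C.u : ℚ) ≠ 0 := C.u.ne_zero
  -- over `K = ℚ` the lemmas K1i/K2i carry the `DivisionRing.toRatAlgebra` instance; the goal carries
  -- `Algebra.id`; `convert` bridges the (subsingleton) instance gap at the end.
  have hA := K2i_aeval_monic W₀ ℚ (q / 4)
  rw [show (4 : ℚ) * (q / 4) = q by ring] at hA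
  have hq0 : aeval q (MonicCubic.poly W₀.b₂ (8 * W₀.b₄) (16 * W₀.b₆)) = 0 := by
    rw [MonicCubic.polyQ, Polynomial.aeval_map_algebraMap] at hq; exact hq
  have h16 := (mul_eq_zero.mp (hA.symm.trans hq0)).resolve_left (by norm_num)
  have hB := K1i_aeval_twoTorsionPolynomial_smul W C ℚ (q / 4)
  rw [← hC, h16] at hB
  have hu' : (algebraMap ℚ ℚ (↑C.u : ℚ)) ≠ 0 := by simp
  have hroot := (mul_eq_zero.mp hB.symm).resolve_left (pow_ne_zero _ (inv_ne_zero hu'))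
  convert hroot using 3
  all_goals rfl

/-- **K3 (PROVED from K3a).** The monic model cubic is irreducible over `ℚ`: a cubic is irreducible iff it
has no root (`Polynomial.irreducible_of_degree_le_three_of_not_isRoot`), and a rational root would give
one of `ψ_W` (K3a), contradicting `Irreducible ψ_W` (`degree_eq_one_of_irreducible_of_root`, degree `3`). -/
theorem K3_monic_irreducible (W : WeierstrassCurve ℚ) (C : WeierstrassCurve.VariableChange ℚ)
    (W₀ : WeierstrassCurve ℤ) (hC : W₀.map (Int.castRingHom ℚ) = C • W)
    (hirr : Irreducible W.twoTorsionPolynomial.toPoly) :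
    Irreducible (MonicCubic.polyQ W₀.b₂ (8 * W₀.b₄) (16 * W₀.b₆)) := by
  refine Polynomial.irreducible_of_degree_le_three_of_not_isRoot
    (by rw [MonicCubic.natDegree_polyQ]; decide) fun q hq => ?_
  have hq' : aeval q (MonicCubic.polyQ W₀.b₂ (8 * W₀.b₄) (16 * W₀.b₆)) = 0 := by
    rw [Polynomial.coe_aeval_eq_eval]; exact hq
  have hroot := K3a_rat_root_back W C W₀ hC q hq'
  have h1 := Polynomial.degree_eq_one_of_irreducible_of_root hirr
    (show IsRoot W.twoTorsionPolynomial.toPoly _ by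
      rw [Polynomial.IsRoot.def, ← Polynomial.coe_aeval_eq_eval]; exact hroot)
  have h3 : W.twoTorsionPolynomial.toPoly.natDegree = 3 :=
    Cubic.natDegree_of_a_ne_zero (by norm_num [WeierstrassCurve.twoTorsionPolynomial])
  rw [Polynomial.degree_eq_natDegree hirr.ne_zero, h3] at h1
  exact absurd h1 (by decide)

/-! ## K4 — THE MATCH: `2⁸ Δ(W₀) = indexDet² · d_K` is two tree theorems (S, PROVED) -/

/-- **K4 (S, PROVED).** For an integral model `W₀` and `η ∈ K` a root of its monic model cubic
(irreducible, `[K:ℚ] = 3`): `2⁸ · Δ(W₀) = I² · d_K` with `I = indexDet ≠ 0` the index `[𝓞_K : ℤ[η]]`.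
`MonicCubic.discr_pb` ∘ `discr_powerBasis_eq_indexDet_sq_mul_discr` ∘ K2b. -/
theorem K4_index_sq_int (W₀ : WeierstrassCurve ℤ) (K : Type) [Field K] [NumberField K] {η : K}
    (hirr : Irreducible (MonicCubic.polyQ W₀.b₂ (8 * W₀.b₄) (16 * W₀.b₆)))
    (hη : aeval η (MonicCubic.poly W₀.b₂ (8 * W₀.b₄) (16 * W₀.b₆)) = 0)
    (h3 : Module.finrank ℚ K = 3) :
    ∃ I : ℤ, I ≠ 0 ∧ (2 : ℤ) ^ 8 * W₀.Δ = I ^ 2 * NumberField.discr K := by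
  refine ⟨indexDet (MonicCubic.pb hirr hη h3) (MonicCubic.isIntegral_pb_gen hirr hη h3),
    indexDet_ne_zero _ _, ?_⟩
  have key := (MonicCubic.discr_pb hirr hη h3).symm.trans
    (discr_powerBasis_eq_indexDet_sq_mul_discr (MonicCubic.pb hirr hη h3)
      (MonicCubic.isIntegral_pb_gen hirr hη h3))
  rw [K2b_monic_disc] at key
  exact_mod_cast key

/-! ## K5 — the integral keystone `2⁸ Δ_min = I² |d_K|` (= k3 `exists_index_sq_eq`, verbatim; PROVED) -/

/-- **K5 (PROVED).** k3's N1★ `exists_index_sq_eq` with its registered signature. -/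
theorem K5_exists_index_sq_eq (W : WeierstrassCurve ℚ) [W.IsElliptic] (K : Type) [Field K]
    [NumberField K] (hirr : Irreducible W.twoTorsionPolynomial.toPoly)
    (hdeg : Module.finrank ℚ K = 3) (hθ : ∃ θ : K, aeval θ W.twoTorsionPolynomial.toPoly = 0) :
    ∃ I : ℕ, 0 < I ∧ 2 ^ 8 * W.minimalDiscriminantNorm ℤ = I ^ 2 * (NumberField.discr K).natAbs := by
  obtain ⟨θ, hθ⟩ := hθ
  obtain ⟨C, hC⟩ := WeierstrassCurve.hasGlobalMinimalModel_rat_holds W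
  haveI := hC
  set W₀ := WeierstrassCurve.integralModelInt (C • W) with hW₀
  have hmap : W₀.map (Int.castRingHom ℚ) = C • W := WeierstrassCurve.map_integralModelInt (C • W)
  have hθ' := K1_root_transport W C K hθ
  rw [← hmap] at hθ'
  have hη := K2a_monic_root W₀ K hθ'
  have hirr' := K3_monic_irreducible W C W₀ hmap hirr
  obtain ⟨I, hI0, hI⟩ := K4_index_sq_int W₀ K hirr' hη hdeg
  have hmin : W.minimalDiscriminantNorm ℤ = W₀.Δ.natAbs := by
    rw [← WeierstrassCurve.minimalDiscriminantNorm_smul_rat W C,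
      WeierstrassCurve.minimalDiscriminantNorm_int_eq_natAbs_minimalDiscriminantInt_holds (C • W)]
    rfl
  refine ⟨I.natAbs, Int.natAbs_pos.mpr hI0, ?_⟩
  have h := congrArg Int.natAbs hI
  rw [Int.natAbs_mul, Int.natAbs_mul, Int.natAbs_pow, Int.natAbs_pow] at h
  rw [hmin]
  simpa using h

/-! ## K6 — the ℚ-form `Δ(W) = q² d_K` (= k3 `DiscSqRatio` = k1 g2 H1 = k2 g2 H0; PROVED) -/

/-- **K6 (PROVED).** `Δ(W) = q² · d_K` with `q = u⁶ I / 16 ≠ 0`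
(K4 on the minimal model, Mathlib `variableChange_Δ`, `map_Δ`). This is k3's `DiscSqRatio` unbundled. -/
theorem K6_Δ_eq_sq_mul_discr (W : WeierstrassCurve ℚ) [W.IsElliptic] (K : Type) [Field K]
    [NumberField K] (hirr : Irreducible W.twoTorsionPolynomial.toPoly)
    (hdeg : Module.finrank ℚ K = 3) (hθ : ∃ θ : K, aeval θ W.twoTorsionPolynomial.toPoly = 0) :
    ∃ q : ℚ, q ≠ 0 ∧ W.Δ = q ^ 2 * (NumberField.discr K : ℚ) := by
  obtain ⟨θ, hθ⟩ := hθ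
  obtain ⟨C, hC⟩ := WeierstrassCurve.hasGlobalMinimalModel_rat_holds W
  haveI := hC
  set W₀ := WeierstrassCurve.integralModelInt (C • W) with hW₀
  have hmap : W₀.map (Int.castRingHom ℚ) = C • W := WeierstrassCurve.map_integralModelInt (C • W)
  have hθ' := K1_root_transport W C K hθ
  rw [← hmap] at hθ'
  have hη := K2a_monic_root W₀ K hθ'
  have hirr' := K3_monic_irreducible W C W₀ hmap hirr
  obtain ⟨I, hI0, hI⟩ := K4_index_sq_int W₀ K hirr' hη hdeg
  -- `(C • W).Δ = u⁻¹² Δ(W)` and `(C • W).Δ = W₀.Δ` (cast)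
  have hΔC : (C • W).Δ = (W₀.Δ : ℚ) := by
    have h := W₀.map_Δ (Int.castRingHom ℚ)
    rw [hmap, eq_intCast] at h
    exact h
  have hvar : (C • W).Δ = (↑C.u⁻¹ : ℚ) ^ 12 * W.Δ := WeierstrassCurve.variableChange_Δ W C
  have hu : ((↑C.u : ℚ)) ≠ 0 := C.u.ne_zero
  refine ⟨(↑C.u : ℚ) ^ 6 * I / 16, ?_, ?_⟩
  · have hI0' : (I : ℚ) ≠ 0 := by exact_mod_cast hI0
    positivity
  · have hIQ : (2 : ℚ) ^ 8 * (W₀.Δ : ℚ) = (I : ℚ) ^ 2 * (NumberField.discr K : ℚ) := by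
      exact_mod_cast hI
    have hinv : (↑C.u⁻¹ : ℚ) = (↑C.u : ℚ)⁻¹ := by simp
    rw [hinv] at hvar
    -- W.Δ = u¹² · W₀.Δ = u¹² · I² d_K / 2⁸
    have hW : W.Δ = (↑C.u : ℚ) ^ 12 * (W₀.Δ : ℚ) := by
      rw [← hΔC, hvar]; field_simp
    rw [hW]
    have : (W₀.Δ : ℚ) = (I : ℚ) ^ 2 * (NumberField.discr K : ℚ) / 2 ^ 8 := by
      rw [← hIQ]; ring
    rw [this]; ring

/-! ## K7 — the two hooks the other slots consume, now sorry-free -/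

/-- k3's `IsResolventField` (StubIdeas3ComplexG3Sketch), verbatim. -/
def IsResolventField (W : WeierstrassCurve ℚ) (K : Type) [Field K] [NumberField K] : Prop :=
  Irreducible W.twoTorsionPolynomial.toPoly ∧ Module.finrank ℚ K = 3 ∧
    ∃ θ : K, aeval θ W.twoTorsionPolynomial.toPoly = 0

/-- k3's H1 `DiscSqRatio` (StubIdeas3ComplexG3Sketch), verbatim — the hypothesis of k3's L1
`ordMinDisc_parity` and L2 `dvd_discr_of_odd_ordMinDisc`, hence of k2 g4 `allowanceDvd`. -/
def DiscSqRatio : Prop :=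
  ∀ (W : WeierstrassCurve ℚ) [W.IsElliptic] (K : Type) [Field K] [NumberField K],
    IsResolventField W K → ∃ q : ℚ, q ≠ 0 ∧ W.Δ = q ^ 2 * (NumberField.discr K : ℚ)

/-- **K7a (PROVED).** `DiscSqRatio` holds outright: feed it to k3 L1/L2 and k2 g4 `allowanceDvd`. -/
theorem discSqRatio : DiscSqRatio := fun W _ K _ _ h => K6_Δ_eq_sq_mul_discr W K h.1 h.2.1 h.2.2

/-- **K7b (PROVED) — the sign door** (k2 g4 `discr_neg_iff_Δ_neg`, there conditional on H0):
on the stub's class `d_K < 0 ↔ Δ(W) < 0`, so `stub_complexCubic` is exactly `IndexSzpiro` on `Δ < 0`. -/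
theorem discr_neg_iff_Δ_neg (W : WeierstrassCurve ℚ) [W.IsElliptic] (K : Type) [Field K]
    [NumberField K] (hirr : Irreducible W.twoTorsionPolynomial.toPoly)
    (hdeg : Module.finrank ℚ K = 3) (hθ : ∃ θ : K, aeval θ W.twoTorsionPolynomial.toPoly = 0) :
    NumberField.discr K < 0 ↔ W.Δ < 0 := by
  obtain ⟨q, hq0, hq⟩ := K6_Δ_eq_sq_mul_discr W K hirr hdeg hθ
  have hq2 : (0 : ℚ) < q ^ 2 := by positivity
  rw [hq, mul_neg_iff]
  constructor
  · intro h; exact Or.inl ⟨hq2, by exact_mod_cast h⟩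
  · rintro (⟨-, h⟩ | ⟨h, -⟩)
    · exact_mod_cast h
    · exact absurd hq2 (not_lt.mpr h.le)

end Summit.ABC.ABC.Cruxes.IndexSzpiro.StubIdeasComplexCubic1G5

end

/-! # §B — k3 g3 `StubIdeas3ComplexG3Sketch.lean`, verbatim lines 39–133 (§0, H1, L1, L2), namespace closed here -/

section

open Polynomial

namespace Summit.ABC.ABC.Cruxes.IndexSzpiro.StubIdeas3ComplexG3

open IsDedekindDomain Rat.HeightOneSpectrum
open Literature.NumberTheory.NumberFields
open scoped NumberField

/-! ## §0 The stub, verbatim, and shorthands (as in gen 0/2) -/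

/-- The registered stub `stub_complexCubic` (signature verbatim). -/
def Stub : Prop :=
  ∀ ε : ℝ, 0 < ε → ∃ C : ℝ, ∀ (W : WeierstrassCurve ℚ) [W.IsElliptic] (K : Type) [Field K]
    [NumberField K], Irreducible W.twoTorsionPolynomial.toPoly → Module.finrank ℚ K = 3 →
    (∃ θ : K, aeval θ W.twoTorsionPolynomial.toPoly = 0) → NumberField.discr K < 0 →
    (W.minimalDiscriminantNorm ℤ : ℝ) ≤
      C * |(NumberField.discr K : ℝ)| * (W.conductorNorm ℤ : ℝ) ^ (6 + ε)

/-- `K` is "the" cubic field of `W`. -/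
def IsResolventField (W : WeierstrassCurve ℚ) (K : Type) [Field K] [NumberField K] : Prop :=
  Irreducible W.twoTorsionPolynomial.toPoly ∧ Module.finrank ℚ K = 3 ∧
    ∃ θ : K, aeval θ W.twoTorsionPolynomial.toPoly = 0

/-- The stub's inequality with constant `C` and exponent `6 + ε` (`ε = 0` allowed). -/
def Ineq (C ε : ℝ) (W : WeierstrassCurve ℚ) [W.IsElliptic] (K : Type) [Field K] [NumberField K] :
    Prop :=
  (W.minimalDiscriminantNorm ℤ : ℝ) ≤ C * |(NumberField.discr K : ℝ)| * (W.conductorNorm ℤ : ℝ) ^ (6 + ε)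

/-- VERIFIED: the stub in shorthand. -/
theorem stub_iff : Stub ↔ ∀ ε : ℝ, 0 < ε → ∃ C : ℝ, ∀ (W : WeierstrassCurve ℚ) [W.IsElliptic]
    (K : Type) [Field K] [NumberField K], IsResolventField W K → NumberField.discr K < 0 →
    Ineq C ε W K := by
  constructor
  · intro h ε hε
    obtain ⟨C, hC⟩ := h ε hε
    exact ⟨C, fun W _ K _ _ hR hd => hC W K hR.1 hR.2.1 hR.2.2 hd⟩
  · intro h ε hε
    obtain ⟨C, hC⟩ := h ε hε
    exact ⟨C, fun W _ K _ _ h1 h2 h3 hd => hC W K ⟨h1, h2, h3⟩ hd⟩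

/-- **H1 `DiscSqRatio` (M, gen 0; = k2's `IndexSquareIdentity` up to `2⁸`).** `Δ(W) = q²·d_K`. -/
def DiscSqRatio : Prop :=
  ∀ (W : WeierstrassCurve ℚ) [W.IsElliptic] (K : Type) [Field K] [NumberField K],
    IsResolventField W K → ∃ q : ℚ, q ≠ 0 ∧ W.Δ = q ^ 2 * (NumberField.discr K : ℚ)

/-! ## §L The local ledger (NEW, gen 3) -/

/-- The local excess at the place `v` (prime `p = natGenerator v`):
`e_v := ord_v Δ_min - v_p(d_K) - 6·f_v`.  The stub is `Σ_v e_v log p_v ≤ log C + ε log N`. -/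
noncomputable def localExcess (W : WeierstrassCurve ℚ) (K : Type) [Field K] [NumberField K]
    (v : HeightOneSpectrum ℤ) : ℤ :=
  (W.ordMinimalDiscriminant v : ℤ) - (padicValInt (natGenerator v) (NumberField.discr K) : ℤ) -
    6 * (W.conductorExponent v : ℤ)

/-- **L1 `ordMinDisc_parity` (S given H1; VERIFIED modulo H1).** At EVERY prime:
`ord_p Δ_min ≡ v_p(d_K) (mod 2)` — from `Δ(W) = q² d_K` and the tree's
`twelve_dvd_ordMinimalDiscriminant_sub_padicValRat_Δ` (`ord_p Δ_min ≡ ord_p Δ(W) mod 12`). -/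
theorem ordMinDisc_parity (hH1 : DiscSqRatio) (W : WeierstrassCurve ℚ) [W.IsElliptic] (K : Type)
    [Field K] [NumberField K] (hR : IsResolventField W K) (v : HeightOneSpectrum ℤ) :
    Even ((W.ordMinimalDiscriminant v : ℤ) - padicValInt (natGenerator v) (NumberField.discr K)) := by
  haveI : Fact (natGenerator v).Prime := ⟨prime_natGenerator v⟩
  obtain ⟨q, hq, hΔ⟩ := hH1 W K hR
  have h12 := W.twelve_dvd_ordMinimalDiscriminant_sub_padicValRat_Δ v
  have hd : (NumberField.discr K : ℚ) ≠ 0 := by exact_mod_cast NumberField.discr_ne_zero K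
  have hval : padicValRat (natGenerator v) W.Δ =
      2 * padicValRat (natGenerator v) q + padicValInt (natGenerator v) (NumberField.discr K) := by
    rw [hΔ, sq, padicValRat.mul (mul_ne_zero hq hq) hd, padicValRat.mul hq hq, padicValRat.of_int]
    ring
  have h2 : (2 : ℤ) ∣ (W.ordMinimalDiscriminant v : ℤ) - padicValRat (natGenerator v) W.Δ :=
    dvd_trans ⟨6, by norm_num⟩ h12
  rw [hval] at h2
  rw [even_iff_two_dvd]
  have : (W.ordMinimalDiscriminant v : ℤ) - padicValInt (natGenerator v) (NumberField.discr K) =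
      ((W.ordMinimalDiscriminant v : ℤ) - (2 * padicValRat (natGenerator v) q +
        padicValInt (natGenerator v) (NumberField.discr K))) + 2 * padicValRat (natGenerator v) q := by
    ring
  rw [this]
  exact dvd_add h2 (dvd_mul_right 2 _)

/-- **L2 `dvd_discr_of_odd_ordMinDisc` (S; VERIFIED from L1) — the allowance lemma for all primes and
all reduction types:** `ord_p Δ_min` odd ⇒ `p ∣ d_K`. -/
theorem dvd_discr_of_odd_ordMinDisc (hH1 : DiscSqRatio) (W : WeierstrassCurve ℚ) [W.IsElliptic]
    (K : Type) [Field K] [NumberField K] (hR : IsResolventField W K) (v : HeightOneSpectrum ℤ)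
    (hodd : Odd (W.ordMinimalDiscriminant v)) :
    ((natGenerator v : ℕ) : ℤ) ∣ NumberField.discr K := by
  haveI : Fact (natGenerator v).Prime := ⟨prime_natGenerator v⟩
  have hev := ordMinDisc_parity hH1 W K hR v
  have hodd' : Odd (W.ordMinimalDiscriminant v : ℤ) := by exact_mod_cast hodd
  have h1 : 1 ≤ padicValInt (natGenerator v) (NumberField.discr K) := by
    rcases hev with ⟨r, hr⟩
    rcases hodd' with ⟨s, hs⟩
    omega
  have := (padicValInt_dvd_iff (p := natGenerator v) 1 (NumberField.discr K)).mpr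
    (Or.inr h1)
  simpa using this

end Summit.ABC.ABC.Cruxes.IndexSzpiro.StubIdeas3ComplexG3

end

/-! # §C — k2 g4 `StubIdeas2G4Sketch.lean`, verbatim lines 28–179 and 184–211 (the sorried `allowanceDvd`,
lines 180–183, OMITTED), namespace closed here -/

section

open Polynomial

namespace Summit.ABC.ABC.Cruxes.IndexSzpiro.StubIdeas2G4

open Summit.ABC.ABC.Theorems.PlaceCountSzpiroPayoff
open Summit.ABC.ABC.Theses.CubicResolventAllowance (IndexSzpiro)
open IsDedekindDomain Rat.HeightOneSpectrum

/-! ## §0 The two registered stubs, verbatim -/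

/-- `stub_complexCubic` (signature verbatim). -/
def StubComplexCubic : Prop :=
  ∀ ε : ℝ, 0 < ε → ∃ C : ℝ, ∀ (W : WeierstrassCurve ℚ) [W.IsElliptic] (K : Type) [Field K]
    [NumberField K], Irreducible W.twoTorsionPolynomial.toPoly → Module.finrank ℚ K = 3 →
    (∃ θ : K, aeval θ W.twoTorsionPolynomial.toPoly = 0) → NumberField.discr K < 0 →
    (W.minimalDiscriminantNorm ℤ : ℝ) ≤
      C * |(NumberField.discr K : ℝ)| * (W.conductorNorm ℤ : ℝ) ^ (6 + ε)

/-- `stub_realCubic` (signature verbatim). -/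
def StubRealCubic : Prop :=
  ∀ ε : ℝ, 0 < ε → ∃ C : ℝ, ∀ (W : WeierstrassCurve ℚ) [W.IsElliptic] (K : Type) [Field K]
    [NumberField K], Irreducible W.twoTorsionPolynomial.toPoly → Module.finrank ℚ K = 3 →
    (∃ θ : K, aeval θ W.twoTorsionPolynomial.toPoly = 0) → 0 < NumberField.discr K →
    (W.minimalDiscriminantNorm ℤ : ℝ) ≤
      C * |(NumberField.discr K : ℝ)| * (W.conductorNorm ℤ : ℝ) ^ (6 + ε)

/-- (S, VERIFIED) the crux gives both stubs — the split loses nothing and, by §T1/§T2, gains nothing. -/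
theorem stubComplex_of_indexSzpiro (h : IndexSzpiro) : StubComplexCubic := by
  intro ε hε
  obtain ⟨C, hC⟩ := h ε hε
  exact ⟨C, fun W _ K _ _ hirr h3 hθ _ => hC W K hirr h3 hθ⟩

theorem stubReal_of_indexSzpiro (h : IndexSzpiro) : StubRealCubic := by
  intro ε hε
  obtain ⟨C, hC⟩ := h ε hε
  exact ⟨C, fun W _ K _ _ hirr h3 hθ _ => hC W K hirr h3 hθ⟩

/-! ## §T1 What `d_K < 0` IS, in typed terms (the sign dictionary's two Lean-visible entries) -/

/-- **H1′ (S, VERIFIED modulo the H1 instance).** Given the square-ratio identity `Δ(W) = q²·d_K`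
(k2 gen-1 `IndexSquareIdentity` / k3 H1 `DiscSqRatio`, M), the complex class is exactly `Δ(W) < 0`,
i.e. `E(ℝ)` connected, i.e. `ψ_W` has one real root. -/
theorem discr_neg_iff_Δ_neg (W : WeierstrassCurve ℚ) (K : Type) [Field K] [NumberField K]
    {q : ℚ} (hq : q ≠ 0) (hΔ : W.Δ = q ^ 2 * (NumberField.discr K : ℚ)) :
    NumberField.discr K < 0 ↔ W.Δ < 0 := by
  have hq2 : 0 < q ^ 2 := by positivity
  constructor
  · intro h
    rw [hΔ]
    exact mul_neg_of_pos_of_neg hq2 (by exact_mod_cast h)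
  · intro h
    rw [hΔ] at h
    refine lt_of_not_ge fun hc => ?_
    have : (0 : ℚ) ≤ q ^ 2 * (NumberField.discr K : ℚ) := mul_nonneg hq2.le (by exact_mod_cast hc)
    linarith

/-- **H2 (S, VERIFIED).** In the complex class `K` has unit rank `1` (one fundamental unit): Brill
(`nrRealPlaces_eq_one_iff_discr_neg_of_finrank_eq_three`, in tree) + `r₁ + 2 r₂ = 3`.  This is the one
place the sign enters any Baker/Thue–Mahler-type size argument over `K` (regulator, not exponent). -/
theorem unitRank_eq_one (K : Type) [Field K] [NumberField K] (h3 : Module.finrank ℚ K = 3)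
    (hd : NumberField.discr K < 0) : NumberField.Units.rank K = 1 := by
  have hr1 : NumberField.InfinitePlace.nrRealPlaces K = 1 :=
    (Literature.NumberTheory.CubicFields.nrRealPlaces_eq_one_iff_discr_neg_of_finrank_eq_three
      K h3).mpr hd
  have hsum := NumberField.InfinitePlace.card_add_two_mul_card_eq_rank K
  have hcard := NumberField.InfinitePlace.card_eq_nrRealPlaces_add_nrComplexPlaces K
  unfold NumberField.Units.rank
  omega

/-! ## §T2 The RE-CUT: `K`-free sign-free kernel + provable allowance lemma -/

/-- The ODD-TOWER RADICAL of `W`: the product of the primes at which `ord_p Δ_min` is odd. -/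
noncomputable def oddRadical (W : WeierstrassCurve ℚ) : ℕ :=
  ∏ p ∈ (W.minimalDiscriminantNorm ℤ).primeFactors.filter
      (fun p => Odd ((W.minimalDiscriminantNorm ℤ).factorization p)), p

theorem oddRadical_pos (W : WeierstrassCurve ℚ) : 0 < oddRadical W :=
  Finset.prod_pos fun _ hp => (Nat.prime_of_mem_primeFactors (Finset.mem_filter.mp hp).1).pos

/-- **K0 `OddTowerSzpiro` — the proposed kernel stub (OPEN, Szpiro-strength; `K`-free, sign-free).**
Szpiro `6+ε` where the primes with an ODD minimal-discriminant exponent are allowed one extra factor `p`.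
Implied by Szpiro `6+ε`; implies `IndexSzpiro` (R3); implied back by `IndexSzpiro` up to `N_add ≤ N`
(`v_p(d_K) ≤ 2`, `= 2` only at additive `p ≥ 5`), so it is the crux's content with `K` eliminated. -/
def OddTowerSzpiro : Prop :=
  ∀ ε : ℝ, 0 < ε → ∃ C : ℝ, ∀ (W : WeierstrassCurve ℚ) [W.IsElliptic],
    Irreducible W.twoTorsionPolynomial.toPoly →
    (W.minimalDiscriminantNorm ℤ : ℝ) ≤ C * (oddRadical W : ℝ) * (W.conductorNorm ℤ : ℝ) ^ (6 + ε)

/-- **R1 `AllowanceDvd` (M — the allowance lemma, global form).** The odd-tower radical divides `d_K`.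
Local input: k3's L2 `dvd_discr_of_odd_ordMinDisc` (VERIFIED modulo H1 `Δ(W) = q² d_K`):
`ord_v Δ_min` odd ⇒ `p_v ∣ d_K`; globalise with `allowanceDvd_of_local` below (VERIFIED). -/
def AllowanceDvd : Prop :=
  ∀ (W : WeierstrassCurve ℚ) [W.IsElliptic] (K : Type) [Field K] [NumberField K],
    Irreducible W.twoTorsionPolynomial.toPoly → Module.finrank ℚ K = 3 →
    (∃ θ : K, aeval θ W.twoTorsionPolynomial.toPoly = 0) →
    (oddRadical W : ℤ) ∣ NumberField.discr K

/-- **R2 `AllowanceLe` (S from R1).** The real-valued form the composition consumes. -/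
def AllowanceLe : Prop :=
  ∀ (W : WeierstrassCurve ℚ) [W.IsElliptic] (K : Type) [Field K] [NumberField K],
    Irreducible W.twoTorsionPolynomial.toPoly → Module.finrank ℚ K = 3 →
    (∃ θ : K, aeval θ W.twoTorsionPolynomial.toPoly = 0) →
    (oddRadical W : ℝ) ≤ |(NumberField.discr K : ℝ)|

/-- (S, VERIFIED) `R1 → R2`: a divisor of the non-zero integer `d_K` is at most `|d_K|`. -/
theorem allowanceLe_of_dvd (h : AllowanceDvd) : AllowanceLe := by
  intro W _ K _ _ hirr h3 hθ
  have hdvd := h W K hirr h3 hθ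
  have hle : (oddRadical W : ℤ) ≤ |NumberField.discr K| :=
    Int.le_of_dvd (abs_pos.mpr (NumberField.discr_ne_zero K)) ((dvd_abs _ _).mpr hdvd)
  have : ((oddRadical W : ℤ) : ℝ) ≤ ((|NumberField.discr K| : ℤ) : ℝ) := by exact_mod_cast hle
  simpa [Int.cast_abs] using this

/-- (S, VERIFIED) LOCAL-TO-GLOBAL for R1, prime form: if every prime with odd exponent in `|Δ_min|`
divides `d_K`, the odd-tower radical divides `d_K` (distinct primes ⇒ product divides). -/
theorem allowanceDvd_of_primewise
    (hloc : ∀ (W : WeierstrassCurve ℚ) [W.IsElliptic] (K : Type) [Field K] [NumberField K],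
      Irreducible W.twoTorsionPolynomial.toPoly → Module.finrank ℚ K = 3 →
      (∃ θ : K, aeval θ W.twoTorsionPolynomial.toPoly = 0) →
      ∀ p : ℕ, p.Prime → Odd ((W.minimalDiscriminantNorm ℤ).factorization p) →
        (p : ℤ) ∣ NumberField.discr K) :
    AllowanceDvd := by
  intro W _ K _ _ hirr h3 hθ
  have hp := hloc W K hirr h3 hθ
  have hnat : oddRadical W ∣ (NumberField.discr K).natAbs := by
    refine Finset.prod_primes_dvd _ (fun p hp' => ?_) (fun p hp' => ?_)
    · exact (Nat.prime_of_mem_primeFactors (Finset.mem_filter.mp hp').1).prime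
    · have hm := Finset.mem_filter.mp hp'
      exact Int.ofNat_dvd_left.mp (hp p (Nat.prime_of_mem_primeFactors hm.1) hm.2)
  exact Int.ofNat_dvd_left.mpr hnat

/-- (S, VERIFIED) LOCAL-TO-GLOBAL for R1, place form = the exact shape of k3's L2: places `v` of `ℤ`,
`p_v = natGenerator v`, `ord_v Δ_min = (|Δ_min|).factorization p_v`
(`factorization_minimalDiscriminantNorm_holds`, PROVED in tree). -/
theorem allowanceDvd_of_local
    (hloc : ∀ (W : WeierstrassCurve ℚ) [W.IsElliptic] (K : Type) [Field K] [NumberField K],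
      Irreducible W.twoTorsionPolynomial.toPoly → Module.finrank ℚ K = 3 →
      (∃ θ : K, aeval θ W.twoTorsionPolynomial.toPoly = 0) →
      ∀ v : HeightOneSpectrum ℤ, Odd (W.ordMinimalDiscriminant v) →
        ((natGenerator v : ℕ) : ℤ) ∣ NumberField.discr K) :
    AllowanceDvd := by
  refine allowanceDvd_of_primewise fun W _ K _ _ hirr h3 hθ p hp hodd => ?_
  set v : HeightOneSpectrum ℤ := (primesEquiv (R := ℤ)).symm ⟨p, hp⟩ with hv
  have hgen : natGenerator v = p := by
    have h := (primesEquiv (R := ℤ)).apply_symm_apply ⟨p, hp⟩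
    exact congrArg Subtype.val h
  have hfac := W.factorization_minimalDiscriminantNorm_holds v
  rw [hgen] at hfac
  have hodd' : Odd (W.ordMinimalDiscriminant v) := by rwa [← hfac]
  have := hloc W K hirr h3 hθ v hodd'
  rwa [hgen] at this

/-- **R3 (S, VERIFIED) — the re-cut composition, concluding the crux BY NAME.**
`OddTowerSzpiro → AllowanceLe → IndexSzpiro`. -/
theorem indexSzpiro_of_oddTower (hK : OddTowerSzpiro) (hA : AllowanceLe) : IndexSzpiro := by
  intro ε hε
  obtain ⟨C, hC⟩ := hK ε hε
  refine ⟨max C 0, ?_⟩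
  intro W _ K _ _ hirr h3 hθ
  have h1 := hC W hirr
  have hRle := hA W K hirr h3 hθ
  have hR0 : (0 : ℝ) ≤ (oddRadical W : ℝ) := Nat.cast_nonneg _
  have hN0 : (0 : ℝ) ≤ (W.conductorNorm ℤ : ℝ) ^ (6 + ε) := Real.rpow_nonneg (Nat.cast_nonneg _) _
  have hmax0 : (0 : ℝ) ≤ max C 0 := le_max_right _ _
  calc (W.minimalDiscriminantNorm ℤ : ℝ)
      ≤ C * (oddRadical W : ℝ) * (W.conductorNorm ℤ : ℝ) ^ (6 + ε) := h1
    _ ≤ max C 0 * (oddRadical W : ℝ) * (W.conductorNorm ℤ : ℝ) ^ (6 + ε) :=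
        mul_le_mul_of_nonneg_right (mul_le_mul_of_nonneg_right (le_max_left C 0) hR0) hN0
    _ ≤ max C 0 * |(NumberField.discr K : ℝ)| * (W.conductorNorm ℤ : ℝ) ^ (6 + ε) :=
        mul_le_mul_of_nonneg_right (mul_le_mul_of_nonneg_left hRle hmax0) hN0

/-- The re-cut in skeleton clothing: the composition the lead would register INSTEAD of the sign
split (`stub_oddTowerSzpiro` OPEN kernel; `stub_allowanceDvd` M). -/
theorem IndexSzpiro_of' (h₁ : OddTowerSzpiro) (h₂ : AllowanceDvd) : IndexSzpiro :=
  indexSzpiro_of_oddTower h₁ (allowanceLe_of_dvd h₂)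

/-- … and the current stubs drop out of it (so no work on the re-cut is lost for the old cut). -/
theorem stubComplex_of_recut (h₁ : OddTowerSzpiro) (h₂ : AllowanceDvd) : StubComplexCubic :=
  stubComplex_of_indexSzpiro (IndexSzpiro_of' h₁ h₂)


end Summit.ABC.ABC.Cruxes.IndexSzpiro.StubIdeas2G4

end

/-! # §D — k2 g7r `StubIdeas2RealG7Sketch.lean`, verbatim lines 22–76 (§0, §R), namespace and section closed here -/

noncomputable section

open Polynomial NumberField WeierstrassCurve

namespace Summit.ABC.ABC.Cruxes.IndexSzpiro.StubIdeas2RealG7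

/-! ## §0 The two registered stubs, verbatim (skeleton `line2-birth.lean`, sha d34fb8f2…) -/

/-- `stub_realCubic`, verbatim. -/
def StubRealCubic : Prop :=
  ∀ ε : ℝ, 0 < ε → ∃ C : ℝ, ∀ (W : WeierstrassCurve ℚ) [W.IsElliptic] (K : Type) [Field K] [NumberField K],
    Irreducible W.twoTorsionPolynomial.toPoly → Module.finrank ℚ K = 3 →
    (∃ θ : K, aeval θ W.twoTorsionPolynomial.toPoly = 0) → 0 < NumberField.discr K →
    (W.minimalDiscriminantNorm ℤ : ℝ) ≤ C * |(NumberField.discr K : ℝ)| * (W.conductorNorm ℤ : ℝ) ^ (6 + ε)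

/-- `stub_complexCubic`, verbatim. -/
def StubComplexCubic : Prop :=
  ∀ ε : ℝ, 0 < ε → ∃ C : ℝ, ∀ (W : WeierstrassCurve ℚ) [W.IsElliptic] (K : Type) [Field K] [NumberField K],
    Irreducible W.twoTorsionPolynomial.toPoly → Module.finrank ℚ K = 3 →
    (∃ θ : K, aeval θ W.twoTorsionPolynomial.toPoly = 0) → NumberField.discr K < 0 →
    (W.minimalDiscriminantNorm ℤ : ℝ) ≤ C * |(NumberField.discr K : ℝ)| * (W.conductorNorm ℤ : ℝ) ^ (6 + ε)

/-! ## §R  The sign split is free: the two stubs are EXACTLY the crux (no slack either way) -/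

/-- **R1 (S, PROVED).** `IndexSzpiro ↔ stub_realCubic ∧ stub_complexCubic` (`d_K ≠ 0`, Mathlib
`NumberField.discr_ne_zero`; the `→` directions are restrictions, `←` takes `C = max C₊ C₋`).  Reading: the registered
composition `IndexSzpiro_of` loses nothing and adds nothing — any proof of one half that does not use the infinite
place proves the other half verbatim. [folklore] -/
theorem indexSzpiro_iff :
    Summit.ABC.ABC.Theses.CubicResolventAllowance.IndexSzpiro ↔ StubRealCubic ∧ StubComplexCubic := by
  constructor
  · intro h
    refine ⟨fun ε hε => ?_, fun ε hε => ?_⟩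
    · obtain ⟨C, hC⟩ := h ε hε
      exact ⟨C, fun W _ K _ _ hirr hdeg hθ _ => hC W K hirr hdeg hθ⟩
    · obtain ⟨C, hC⟩ := h ε hε
      exact ⟨C, fun W _ K _ _ hirr hdeg hθ _ => hC W K hirr hdeg hθ⟩
  · rintro ⟨hpos, hneg⟩ ε hε
    obtain ⟨C₁, h₁⟩ := hpos ε hε
    obtain ⟨C₂, h₂⟩ := hneg ε hε
    refine ⟨max C₁ C₂, fun W _ K _ _ hirr hdeg hθ => ?_⟩
    have hnn : (0 : ℝ) ≤ |(NumberField.discr K : ℝ)| * (W.conductorNorm ℤ : ℝ) ^ (6 + ε) := by positivity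
    rcases lt_or_gt_of_ne (NumberField.discr_ne_zero K) with hlt | hgt
    · calc (W.minimalDiscriminantNorm ℤ : ℝ) ≤ C₂ * |(NumberField.discr K : ℝ)| * (W.conductorNorm ℤ : ℝ) ^ (6 + ε) :=
            h₂ W K hirr hdeg hθ hlt
        _ = C₂ * (|(NumberField.discr K : ℝ)| * (W.conductorNorm ℤ : ℝ) ^ (6 + ε)) := by ring
        _ ≤ max C₁ C₂ * (|(NumberField.discr K : ℝ)| * (W.conductorNorm ℤ : ℝ) ^ (6 + ε)) :=
            mul_le_mul_of_nonneg_right (le_max_right _ _) hnn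
        _ = max C₁ C₂ * |(NumberField.discr K : ℝ)| * (W.conductorNorm ℤ : ℝ) ^ (6 + ε) := by ring
    · calc (W.minimalDiscriminantNorm ℤ : ℝ) ≤ C₁ * |(NumberField.discr K : ℝ)| * (W.conductorNorm ℤ : ℝ) ^ (6 + ε) :=
            h₁ W K hirr hdeg hθ hgt
        _ = C₁ * (|(NumberField.discr K : ℝ)| * (W.conductorNorm ℤ : ℝ) ^ (6 + ε)) := by ring
        _ ≤ max C₁ C₂ * (|(NumberField.discr K : ℝ)| * (W.conductorNorm ℤ : ℝ) ^ (6 + ε)) :=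
            mul_le_mul_of_nonneg_right (le_max_left _ _) hnn
        _ = max C₁ C₂ * |(NumberField.discr K : ℝ)| * (W.conductorNorm ℤ : ℝ) ^ (6 + ε) := by ring

end Summit.ABC.ABC.Cruxes.IndexSzpiro.StubIdeas2RealG7

end

/-! # §E — NEW (gen 17): the assembly, no hypothesis left -/

namespace Summit.ABC.ABC.Cruxes.IndexSzpiro.StubIdeas2G17

open Summit.ABC.ABC.Theses.CubicResolventAllowance (IndexSzpiro)

/-- Bridge: k3's copy of H1 `DiscSqRatio` (the hypothesis of its L1/L2) holds, by k1 g5 `K6`. -/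
theorem discSqRatio₃ : StubIdeas3ComplexG3.DiscSqRatio :=
  fun W _ K _ _ h => StubIdeasComplexCubic1G5.K6_Δ_eq_sq_mul_discr W K h.1 h.2.1 h.2.2

/-- **`AllowanceDvd`, unconditionally** (was the one `sorry` of k2 g4): for every `W/ℚ` with irreducible
2-division cubic and every cubic field `K` with a root of it, the odd-tower radical of `Δ_min(W)` divides `d_K`. -/
theorem allowanceDvd' : StubIdeas2G4.AllowanceDvd :=
  StubIdeas2G4.allowanceDvd_of_local fun W _ K _ _ hirr h3 hθ v hodd =>
    StubIdeas3ComplexG3.dvd_discr_of_odd_ordMinDisc discSqRatio₃ W K ⟨hirr, h3, hθ⟩ v hodd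

/-- **The re-cut, unconditional:** the crux BY NAME from the `K`-free, sign-free kernel `OddTowerSzpiro`. -/
theorem indexSzpiro_of_oddTowerSzpiro (h : StubIdeas2G4.OddTowerSzpiro) : IndexSzpiro :=
  StubIdeas2G4.IndexSzpiro_of' h allowanceDvd'

/-- … and the registered stub `stub_complexCubic` drops out of it. -/
theorem stubComplex_of_oddTowerSzpiro (h : StubIdeas2G4.OddTowerSzpiro) :
    StubIdeas2G4.StubComplexCubic :=
  StubIdeas2G4.stubComplex_of_recut h allowanceDvd'

/-- The sign split carries no information (k2 g7r merge lemma), restated next to the re-cut. -/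
theorem indexSzpiro_iff_stubs :
    IndexSzpiro ↔ StubIdeas2RealG7.StubRealCubic ∧ StubIdeas2RealG7.StubComplexCubic :=
  StubIdeas2RealG7.indexSzpiro_iff

open Literature.NumberTheory.EllipticCurves (SzpiroConjecture)

/-- Calibration from above (S, PROVED): Szpiro `6+ε` gives the kernel, since `1 ≤ oddRadical W`.  With
`indexSzpiro_of_oddTowerSzpiro` and k1 g6/g18 (`Stub → GenEll.ABCWithExponent 8`) this places the kernel:
`abc ⇒ SzpiroConjecture ⇒ OddTowerSzpiro ⇒ IndexSzpiro ⇒ stub_complexCubic ⇒ abc with exponent 8`. -/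
theorem oddTowerSzpiro_of_szpiro (hS : SzpiroConjecture) : StubIdeas2G4.OddTowerSzpiro := by
  intro ε hε
  obtain ⟨C, hC⟩ := hS ε hε
  refine ⟨max C 0, fun W _ _ => ?_⟩
  have h1 := hC W
  have hR : (1 : ℝ) ≤ (StubIdeas2G4.oddRadical W : ℝ) :=
    Nat.one_le_cast.mpr (Nat.one_le_iff_ne_zero.mpr (StubIdeas2G4.oddRadical_pos W).ne')
  have hN0 : (0 : ℝ) ≤ (W.conductorNorm ℤ : ℝ) ^ (6 + ε) := Real.rpow_nonneg (Nat.cast_nonneg _) _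
  calc (W.minimalDiscriminantNorm ℤ : ℝ) ≤ C * (W.conductorNorm ℤ : ℝ) ^ (6 + ε) := h1
    _ ≤ max C 0 * (W.conductorNorm ℤ : ℝ) ^ (6 + ε) := mul_le_mul_of_nonneg_right (le_max_left _ _) hN0
    _ = max C 0 * 1 * (W.conductorNorm ℤ : ℝ) ^ (6 + ε) := by ring
    _ ≤ max C 0 * (StubIdeas2G4.oddRadical W : ℝ) * (W.conductorNorm ℤ : ℝ) ^ (6 + ε) :=
        mul_le_mul_of_nonneg_right (mul_le_mul_of_nonneg_left hR (le_max_right _ _)) hN0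

/-- Hence the crux itself from Szpiro `6+ε` through the re-cut (S, PROVED; = k1 g6 `stub_of_szpiro` for the
whole crux, now factored through the kernel). -/
theorem indexSzpiro_of_szpiro (hS : SzpiroConjecture) : IndexSzpiro :=
  indexSzpiro_of_oddTowerSzpiro (oddTowerSzpiro_of_szpiro hS)

#print axioms allowanceDvd'
#print axioms indexSzpiro_of_oddTowerSzpiro
#print axioms indexSzpiro_iff_stubs
#print axioms indexSzpiro_of_szpiro

end Summit.ABC.ABC.Cruxes.IndexSzpiro.StubIdeas2G17
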